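import Literature.Geometry.Symplectic.PencilEndFarFrame
import Literature.Topology.FourManifolds.SphereInHomotopyFourSphereTube
import HarnessLib

/-!
# The core normal frame of a compactified pencil member and its flat asymptotics

Topic `Literature/Geometry/Symplectic` (infrastructure for
`Literature.Geometry.Symplectic.jPlanePencil_localFamily_homotopySphere`, Wendl LNM 2216, proof of
Prop. 2.53, p. 65: the compactified member of the pencil has trivial normal bundle in the blown-up
end).

For a member `u` of the pencil at `p` (a `J`-holomorphic plane `ℂ → M ∖ p` asymptotic to the line
of intercept `b`) with capped sphere `û = capGlue u : ℂℙ¹ → M`, and a normal framing `N` of `û` in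
`M` (Kirby VIII.2 in a homotopy `4`-sphere, `exists_normalFraming_capGlue`), we record:

* asymptotics of the member in the flat end: `w' → 0` (`tendsto_deriv_snd`), the flat direction of
  the recentred chart vector (`tendsto_flatCx_snd_div_norm`), the affine parametrisation tends to
  `∞` (`tendsto_linePt_zero_cocompact`);
* the tangent plane of `û` at `p`: `d(pencilCap)(0) ζ = flatCx⁻¹ (conj ζ, 0)`
  (`hasMFDerivAt_pencilCap_zero`), so the tangent plane at `p` is the `z`-plane and the normal
  frame at `∞` has invertible `w`-component (`injective_sndFlat_frame_inf`);
* the **core frame** `coreFrame = ‖e(u ξ) − e p‖² • N(σ₀ ξ) ∘ A` (`A` normalising the `w`-components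
  at `∞`), the **tangent-killing functional** `Λ_ξ (V_z, V_w) = z' V_w − w' V_z` of the flat
  coordinates, which kills `du(ξ)` (`tanKill_flatDeriv_mfderiv`), takes the far frame to `z' c`
  and the core frame to `c + o(1) c` (`norm_tanKill_coreFrame_sub_le`, `exists_coreFrame_radius`).

## References

* C. Wendl, *Holomorphic Curves in Low Dimensions*, LNM 2216 (2018), proof of Prop. 2.53, p. 65.
  [Wendl2018]
* R. C. Kirby, *The Topology of 4-Manifolds*, LNM 1374 (1989), Ch. VIII, Thm. 2. [Kirby1989]
-/

noncomputable section

open scoped Manifold ContDiff Topology RealInnerProductSpace ComplexConjugate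
open Set Function Metric Filter Literature.Topology.FourManifolds
  Literature.Topology.FourManifolds.ComplexProjectiveSpace

namespace Literature.Geometry.Symplectic

/-! ### §1 Asymptotics of a member in the flat end -/

section Asymptotics

variable {M : Type*} [TopologicalSpace M] [T2Space M] [ChartedSpace (EuclideanSpace ℝ (Fin 4)) M]
  {p : M} {J : ∀ x : punctured p, TangentSpace (𝓡 4) x →L[ℝ] TangentSpace (𝓡 4) x}
  {u : ℂ → punctured p} {b : ℂ} {ε : ℝ}

/-- **The second flat coordinate of a member has derivative tending to `0` at infinity**
(Cauchy's estimate on the discs `B(ξ, ‖ξ‖/2)`, on which `w` is holomorphic and uniformly close to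
`b` for `‖ξ‖` large). [folklore] -/
theorem IsPencilPlane.tendsto_deriv_snd [CompactSpace M] [IsManifold (𝓡 4) ∞ M]
    (h : IsPencilPlane J u b) (hε : 0 < ε)
    (hJstd : ∀ x : punctured p, InPuncturedChartBall p ε x →
      ∀ (v : TangentSpace (𝓡 4) x) (c : EuclideanSpace ℝ (Fin 4)),
        inner ℝ (fderiv ℝ inversion (extChartAt (𝓡 4) p x.1 - extChartAt (𝓡 4) p p)
          (mfderiv (𝓡 4) 𝓘(ℝ, EuclideanSpace ℝ (Fin 4))
            (fun z : punctured p => extChartAt (𝓡 4) p z.1) x (J x v))) c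
        = stdSymplecticForm (fderiv ℝ inversion (extChartAt (𝓡 4) p x.1 - extChartAt (𝓡 4) p p)
          (mfderiv (𝓡 4) 𝓘(ℝ, EuclideanSpace ℝ (Fin 4))
            (fun z : punctured p => extChartAt (𝓡 4) p z.1) x v)) c) :
    Tendsto (fun ξ : ℂ => deriv (fun η : ℂ => (pencilCoord p (u η)).2) ξ) (cocompact ℂ) (𝓝 0) := by
  obtain ⟨R, hD, -⟩ := h.exists_differentiableOn_pencilCoord hε hJstd
  have hgD : ∀ ξ : ℂ, R ≤ ‖ξ‖ → DifferentiableAt ℂ (fun η : ℂ => (pencilCoord p (u η)).2) ξ :=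
    fun ξ hξ => (hD ξ hξ).snd
  rw [Metric.tendsto_nhds]
  intro δ hδ
  have hsmall : ∀ᶠ η in cocompact ℂ, ‖(pencilCoord p (u η)).2 - b‖ < δ / 8 := by
    have := (Metric.tendsto_nhds.1 h.tendsto_snd) (δ / 8) (by positivity)
    simpa [dist_eq_norm] using this
  obtain ⟨R', hR'⟩ := exists_forall_norm_le_of_eventually_cocompact hsmall
  refine eventually_cocompact_of_forall_norm_le (T := max (2 * R') (2 * |R| + 2)) fun ξ hξ => ?_
  have hξR' : 2 * R' ≤ ‖ξ‖ := le_trans (le_max_left _ _) hξ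
  have hξR : 2 * |R| + 2 ≤ ‖ξ‖ := le_trans (le_max_right _ _) hξ
  have hRabs : R ≤ |R| := le_abs_self R
  have habs : 0 ≤ |R| := abs_nonneg R
  have hball : ∀ η ∈ Metric.ball ξ (‖ξ‖ / 2), ‖ξ‖ / 2 ≤ ‖η‖ := fun η hη => by
    have h1 : ‖η - ξ‖ < ‖ξ‖ / 2 := by rwa [← dist_eq_norm]
    have h2 : ‖ξ‖ - ‖η‖ ≤ ‖ξ - η‖ := norm_sub_norm_le ξ η
    rw [norm_sub_rev] at h2
    linarith
  have hsub : DifferentiableOn ℂ (fun η : ℂ => (pencilCoord p (u η)).2) (Metric.ball ξ (‖ξ‖ / 2)) :=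
    fun η hη => (hgD η (by linarith [hball η hη])).differentiableWithinAt
  have hmaps : MapsTo (fun η : ℂ => (pencilCoord p (u η)).2) (Metric.ball ξ (‖ξ‖ / 2))
      (Metric.closedBall ((pencilCoord p (u ξ)).2) (δ / 4)) := fun η hη => by
    have h1 : ‖(pencilCoord p (u η)).2 - b‖ < δ / 8 := hR' η (by linarith [hball η hη])
    have h2 : ‖(pencilCoord p (u ξ)).2 - b‖ < δ / 8 := hR' ξ (by linarith)
    show dist ((pencilCoord p (u η)).2) ((pencilCoord p (u ξ)).2) ≤ δ / 4
    rw [dist_eq_norm]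
    have h3 : (pencilCoord p (u η)).2 - (pencilCoord p (u ξ)).2 =
        ((pencilCoord p (u η)).2 - b) - ((pencilCoord p (u ξ)).2 - b) := by ring
    rw [h3]
    linarith [norm_sub_le ((pencilCoord p (u η)).2 - b) ((pencilCoord p (u ξ)).2 - b)]
  have hderiv : ‖deriv (fun η : ℂ => (pencilCoord p (u η)).2) ξ‖ ≤ (δ / 4) / (‖ξ‖ / 2) :=
    Complex.norm_deriv_le_div_of_mapsTo_ball hsub hmaps (by linarith)
  have hle : (δ / 4) / (‖ξ‖ / 2) ≤ δ / 2 := by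
    rw [div_le_iff₀ (by linarith)]
    nlinarith
  show dist (deriv (fun η : ℂ => (pencilCoord p (u η)).2) ξ) 0 < δ
  rw [dist_zero_right]
  linarith

/-- **The real derivative of the flat coordinates of a member in terms of the complex derivatives**
`z' = deriv z`, `w' = deriv w`: `d(pencilCoord ∘ u)(ξ) ζ = (ζ z', ζ w')`, at a point of complex
differentiability. [folklore] -/
theorem fderiv_real_pencilCoord_comp_apply {ξ : ℂ}
    (hd : DifferentiableAt ℂ (fun η : ℂ => pencilCoord p (u η)) ξ) (ζ : ℂ) :
    fderiv ℝ (fun η : ℂ => pencilCoord p (u η)) ξ ζ =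
      (ζ * deriv (fun η : ℂ => (pencilCoord p (u η)).1) ξ,
        ζ * deriv (fun η : ℂ => (pencilCoord p (u η)).2) ξ) := by
  have h1 : HasDerivAt (fun η : ℂ => pencilCoord p (u η))
      (deriv (fun η : ℂ => (pencilCoord p (u η)).1) ξ,
        deriv (fun η : ℂ => (pencilCoord p (u η)).2) ξ) ξ :=
    hd.fst.hasDerivAt.prodMk hd.snd.hasDerivAt
  rw [(h1.hasFDerivAt.restrictScalars ℝ).fderiv]
  simp [Prod.smul_mk, smul_eq_mul]

omit [T2Space M] in
/-- The flat coordinates of the recentred chart vector: `flatCx (e x − e p) = ‖X‖⁻² • (z, w)` with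
`X = flatCx⁻¹ (z, w)`, `(z, w) = pencilCoord p x`. [folklore] -/
theorem flatCx_recentre_eq [T2Space M] (x : punctured p) :
    flatCx (recentre p x.1) =
      (‖flatCx.symm (pencilCoord p x)‖ ^ 2)⁻¹ • pencilCoord p x := by
  rw [recentre, extChartAt_sub_eq_inversion_pencilCoord, inversion, map_smul,
    ContinuousLinearEquiv.apply_symm_apply]

/-- The norm of the recentred chart vector: `‖e x − e p‖ = ‖X‖⁻¹`, `X = flatCx⁻¹ (pencilCoord p x)`.
[folklore] -/
theorem norm_recentre_eq (x : punctured p) :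
    ‖recentre p x.1‖ = ‖flatCx.symm (pencilCoord p x)‖⁻¹ := by
  rw [recentre, extChartAt_sub_eq_inversion_pencilCoord, inversion, norm_smul, norm_inv, norm_pow,
    Real.norm_eq_abs, abs_norm]
  rcases eq_or_ne ‖flatCx.symm (pencilCoord p x)‖ 0 with h0 | h0
  · rw [h0]; simp
  · field_simp

/-- **The recentred chart vector of a member points asymptotically into the `z`-plane**:
`‖(flatCx (e(u ξ) − e p)).2‖ / ‖e(u ξ) − e p‖ → 0` (it equals `‖w‖/‖(z, w)‖ ≤ ‖w‖/‖z‖`).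
[folklore] -/
theorem IsPencilPlane.tendsto_flatCx_snd_div_norm (h : IsPencilPlane J u b) :
    Tendsto (fun ξ : ℂ => ‖(flatCx (recentre p (u ξ).1)).2‖ / ‖recentre p (u ξ).1‖)
      (cocompact ℂ) (𝓝 0) := by
  -- eventually the ratio is `≤ ‖w‖ / ‖z‖`
  have hz1 : ∀ᶠ ξ in cocompact ℂ, 1 < ‖(pencilCoord p (u ξ)).1‖ :=
    h.tendsto_norm_fst.eventually_gt_atTop 1
  have hle : ∀ᶠ ξ in cocompact ℂ,
      ‖(flatCx (recentre p (u ξ).1)).2‖ / ‖recentre p (u ξ).1‖ ≤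
        ‖(pencilCoord p (u ξ)).2‖ * ‖(pencilCoord p (u ξ)).1‖⁻¹ := by
    filter_upwards [hz1] with ξ hξ
    set q := pencilCoord p (u ξ) with hq
    have hzpos : 0 < ‖q.1‖ := lt_trans one_pos hξ
    have hX : ‖q.1‖ ≤ ‖flatCx.symm q‖ := by
      have h1 : ‖flatCx.symm q‖ ^ 2 = ‖q.1‖ ^ 2 + ‖q.2‖ ^ 2 := by
        rw [← norm_sq_flatCx_symm q.1 q.2]
      nlinarith [norm_nonneg q.2, norm_nonneg (flatCx.symm q), sq_nonneg (‖flatCx.symm q‖ - ‖q.1‖)]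
    have hXpos : 0 < ‖flatCx.symm q‖ := lt_of_lt_of_le hzpos hX
    rw [flatCx_recentre_eq, norm_recentre_eq, Prod.smul_snd, norm_smul, norm_inv, norm_pow,
      Real.norm_eq_abs, abs_norm]
    rw [show ‖flatCx.symm q‖ ^ 2 = ‖flatCx.symm q‖ * ‖flatCx.symm q‖ from sq _]
    have : (‖flatCx.symm q‖ * ‖flatCx.symm q‖)⁻¹ * ‖q.2‖ / ‖flatCx.symm q‖⁻¹ =
        ‖q.2‖ * ‖flatCx.symm q‖⁻¹ := by
      field_simp
    rw [this]
    gcongr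
  have hlim : Tendsto (fun ξ : ℂ => ‖(pencilCoord p (u ξ)).2‖ * ‖(pencilCoord p (u ξ)).1‖⁻¹)
      (cocompact ℂ) (𝓝 0) := by
    have h1 : Tendsto (fun ξ : ℂ => ‖(pencilCoord p (u ξ)).2‖) (cocompact ℂ) (𝓝 ‖b‖) :=
      h.tendsto_snd.norm
    have h2 : Tendsto (fun ξ : ℂ => ‖(pencilCoord p (u ξ)).1‖⁻¹) (cocompact ℂ) (𝓝 0) :=
      h.tendsto_norm_fst.inv_tendsto_atTop
    simpa using h1.mul h2
  refine squeeze_zero' (Eventually.of_forall fun ξ => by positivity) hle hlim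

/-- **The affine parametrisation tends to the point at infinity**: `σ₀ ξ → [0 : 1]` as `ξ → ∞`.
[folklore] -/
theorem tendsto_linePt_zero_cocompact :
    Tendsto (CodimTwoData.linePt 0) (cocompact ℂ) (𝓝 (CodimTwoData.linePt 1 0)) := by
  have h1 : Tendsto (fun ξ : ℂ => ξ⁻¹) (cocompact ℂ) (𝓝 0) := by
    rw [← Metric.cobounded_eq_cocompact]; exact Filter.tendsto_inv₀_cobounded
  have h2 : Tendsto (fun ξ : ℂ => CodimTwoData.linePt 1 ξ⁻¹) (cocompact ℂ) (𝓝 (CodimTwoData.linePt 1 0)) :=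
    ((CodimTwoData.continuous_linePt 1).tendsto 0).comp h1
  refine h2.congr' ?_
  have hev : ∀ᶠ ξ : ℂ in cocompact ℂ, ξ ≠ 0 := by
    rw [← Metric.cobounded_eq_cocompact]
    exact Bornology.eventually_ne_cobounded 0
  filter_upwards [hev] with ξ hξ
  exact CodimTwoData.linePt_one_inv hξ

end Asymptotics

/-! ### §2 The tangent plane of the capped sphere at the base point -/

section CapTangent

variable {M : Type} [TopologicalSpace M] [T2Space M] [ChartedSpace (EuclideanSpace ℝ (Fin 4)) M]
  {p : M} {J : ∀ x : punctured p, TangentSpace (𝓡 4) x →L[ℝ] TangentSpace (𝓡 4) x}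
  {u : ℂ → punctured p} {b : ℂ} {ε : ℝ}

/-- The derivative of `capModel` at the origin: `(a, c) ↦ flatCx⁻¹ (conj a, 0)`. [folklore] -/
def capModelDeriv : ℂ × ℂ →L[ℝ] EuclideanSpace ℝ (Fin 4) :=
  (flatCx.symm : ℂ × ℂ →L[ℝ] EuclideanSpace ℝ (Fin 4)).comp
    ((ContinuousLinearMap.inl ℝ ℂ ℂ).comp
      ((Complex.conjCLE : ℂ →L[ℝ] ℂ).comp (ContinuousLinearMap.fst ℝ ℂ ℂ)))

/-- Values of `capModelDeriv`. [folklore] -/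
@[simp] theorem capModelDeriv_apply (q : ℂ × ℂ) : capModelDeriv q = flatCx.symm (conj q.1, 0) := rfl

/-- **`capModel` has derivative `capModelDeriv` at the origin** (the factor `(1 + |W|²)⁻¹` is `1`
to first order and `W conj X` vanishes to second order). [folklore] -/
theorem hasFDerivAt_capModel_zero : HasFDerivAt capModel capModelDeriv ((0 : ℂ), (0 : ℂ)) := by
  have hc : HasFDerivAt (fun q : ℂ × ℂ => conj q.1)
      ((Complex.conjCLE : ℂ →L[ℝ] ℂ).comp (ContinuousLinearMap.fst ℝ ℂ ℂ)) ((0 : ℂ), (0 : ℂ)) :=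
    Complex.conjCLE.hasFDerivAt.comp _ hasFDerivAt_fst
  have hm : HasFDerivAt (fun q : ℂ × ℂ => q.2 * conj q.1) (0 : ℂ × ℂ →L[ℝ] ℂ) ((0 : ℂ), (0 : ℂ)) := by
    have h := (hasFDerivAt_snd (𝕜 := ℝ) (E := ℂ) (F := ℂ) (p := ((0 : ℂ), (0 : ℂ)))).mul hc
    refine h.congr_fderiv (ContinuousLinearMap.ext fun q => ?_)
    simp
  have hh : HasFDerivAt (fun q : ℂ × ℂ => (conj q.1, q.2 * conj q.1))
      (((Complex.conjCLE : ℂ →L[ℝ] ℂ).comp (ContinuousLinearMap.fst ℝ ℂ ℂ)).prod 0)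
      ((0 : ℂ), (0 : ℂ)) :=
    hc.prodMk hm
  have hφ : DifferentiableAt ℝ (fun q : ℂ × ℂ => (1 + ‖q.2‖ ^ 2)⁻¹) ((0 : ℂ), (0 : ℂ)) := by
    have h1 : DifferentiableAt ℝ (fun q : ℂ × ℂ => 1 + ‖q.2‖ ^ 2) ((0 : ℂ), (0 : ℂ)) :=
      (differentiableAt_const _).add (differentiableAt_snd.norm_sq ℝ)
    exact h1.inv (by positivity)
  have hs := hφ.hasFDerivAt.smul hh
  have hcomp := flatCx.symm.hasFDerivAt.comp ((0 : ℂ), (0 : ℂ)) hs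
  refine hcomp.congr_fderiv (ContinuousLinearMap.ext fun q => ?_)
  simp [capModelDeriv_apply]

/-- **The tangent map of the cap at the base point**: `ζ ↦ flatCx⁻¹ (conj ζ, 0)`. [folklore] -/
def capTangent : ℂ →L[ℝ] EuclideanSpace ℝ (Fin 4) :=
  (flatCx.symm : ℂ × ℂ →L[ℝ] EuclideanSpace ℝ (Fin 4)).comp
    ((ContinuousLinearMap.inl ℝ ℂ ℂ).comp (Complex.conjCLE : ℂ →L[ℝ] ℂ))

/-- Values of `capTangent`. [folklore] -/
@[simp] theorem capTangent_apply (ζ : ℂ) : capTangent ζ = flatCx.symm (conj ζ, 0) := rfl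

/-- Flat coordinates of `capTangent ζ`. [folklore] -/
theorem flatCx_capTangent (ζ : ℂ) : flatCx (capTangent ζ) = (conj ζ, 0) := by
  simp

variable [CompactSpace M] [IsManifold (𝓡 4) ∞ M]

omit [IsManifold (𝓡 4) ∞ M] in
/-- **The chart expression of the cap has derivative `capTangent` at `0`**: from
`e (pencilCap η) = e p + capModel (X η, W η)` with `(X, W)(0) = 0`, `(X', W')(0) = (1, b)`.
[cite: Wendl2018, proof of Prop. 2.53 (p. 65)] -/
theorem IsPencilPlane.hasFDerivAt_extChartAt_pencilCap_zero (h : IsPencilPlane J u b) (hε : 0 < ε) :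
    HasFDerivAt (fun η : ℂ => extChartAt (𝓡 4) p (pencilCap p u η)) capTangent 0 := by
  obtain ⟨r₁, hr₁, hball⟩ := h.exists_cap_radius hε
  have hXd : HasDerivAt (capX p u) 1 0 := by rw [capX_eq]; exact h.hasDerivAt_inv_fst_zero
  have hWd : HasDerivAt (capW p u) b 0 := by rw [capW_eq]; exact h.hasDerivAt_snd_div_fst_zero
  have hXW : HasFDerivAt (fun η : ℂ => (capX p u η, capW p u η))
      ((ContinuousLinearMap.smulRight (1 : ℂ →L[ℂ] ℂ) ((1 : ℂ), b)).restrictScalars ℝ) 0 :=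
    (hXd.prodMk hWd).hasFDerivAt.restrictScalars ℝ
  have h0 : (capX p u 0, capW p u 0) = ((0 : ℂ), (0 : ℂ)) := by simp
  have hcap : HasFDerivAt capModel capModelDeriv (capX p u 0, capW p u 0) := by
    rw [h0]; exact hasFDerivAt_capModel_zero
  have hcomp := (hcap.comp 0 hXW).const_add (extChartAt (𝓡 4) p p)
  have hz : ∀ η' ∈ ball (0 : ℂ) r₁, η' ≠ 0 → (pencilCoord p (u η'⁻¹)).1 ≠ 0 := fun η' hη' h0' =>
    norm_pos_iff.1 (lt_trans one_pos (hball η' h0' (mem_ball_zero_iff.1 hη')).2)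
  have hEq : (fun η' : ℂ => extChartAt (𝓡 4) p p + capModel (capX p u η', capW p u η')) =ᶠ[𝓝 0]
      fun η' => extChartAt (𝓡 4) p (pencilCap p u η') := by
    filter_upwards [isOpen_ball.mem_nhds (mem_ball_self hr₁)] with η' hη'
    exact (extChartAt_pencilCap (hz η' hη')).symm
  refine (hcomp.congr_of_eventuallyEq hEq.symm).congr_fderiv ?_
  ext1 ζ
  simp [capModelDeriv_apply, capTangent_apply]

/-- **The cap of a member has tangent map `capTangent` at the base point**:
`d(pencilCap p u)(0) ζ = flatCx⁻¹ (conj ζ, 0)`; in particular the tangent plane of the capped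
sphere at `p` is the `z`-plane `flatCx⁻¹ (ℂ × {0})`. [cite: Wendl2018, proof of Prop. 2.53 (p. 65)] -/
theorem IsPencilPlane.hasMFDerivAt_pencilCap_zero (h : IsPencilPlane J u b) (hε : 0 < ε)
    (hJstd : ∀ x : punctured p, InPuncturedChartBall p ε x →
      ∀ (v : TangentSpace (𝓡 4) x) (c : EuclideanSpace ℝ (Fin 4)),
        inner ℝ (fderiv ℝ inversion (extChartAt (𝓡 4) p x.1 - extChartAt (𝓡 4) p p)
          (mfderiv (𝓡 4) 𝓘(ℝ, EuclideanSpace ℝ (Fin 4))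
            (fun z : punctured p => extChartAt (𝓡 4) p z.1) x (J x v))) c
        = stdSymplecticForm (fderiv ℝ inversion (extChartAt (𝓡 4) p x.1 - extChartAt (𝓡 4) p p)
          (mfderiv (𝓡 4) 𝓘(ℝ, EuclideanSpace ℝ (Fin 4))
            (fun z : punctured p => extChartAt (𝓡 4) p z.1) x v)) c) :
    HasMFDerivAt 𝓘(ℝ, ℂ) (𝓡 4) (pencilCap p u) 0 capTangent := by
  have hcap : MDifferentiableAt 𝓘(ℝ, ℂ) (𝓡 4) (pencilCap p u) 0 :=
    (h.contMDiff_pencilCap hε hJstd 0).mdifferentiableAt (by simp)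
  have hsrc : pencilCap p u 0 ∈ (chartAt (EuclideanSpace ℝ (Fin 4)) p).source := by simp
  have hF := (hasMFDerivAt_extChartAt_tangentCoordChange hsrc).comp 0 hcap.hasMFDerivAt
  have hG := (h.hasFDerivAt_extChartAt_pencilCap_zero hε).hasMFDerivAt
  have h1 : (tangentCoordChange (𝓡 4) (pencilCap p u 0) p (pencilCap p u 0)).comp
      (mfderiv 𝓘(ℝ, ℂ) (𝓡 4) (pencilCap p u) 0) = capTangent :=
    hF.mfderiv.symm.trans hG.mfderiv
  have hτ : ∀ v, tangentCoordChange (𝓡 4) (pencilCap p u 0) p (pencilCap p u 0) v = v := by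
    intro v
    rw [pencilCap_zero]
    exact tangentCoordChange_self (mem_extChartAt_source p)
  refine hcap.hasMFDerivAt.congr_mfderiv ?_
  ext1 v
  have h2 := DFunLike.congr_fun h1 v
  have h3 : tangentCoordChange (𝓡 4) (pencilCap p u 0) p (pencilCap p u 0)
      (mfderiv 𝓘(ℝ, ℂ) (𝓡 4) (pencilCap p u) 0 v) = capTangent v := h2
  rw [hτ] at h3
  exact h3

omit [T2Space M] [ChartedSpace (EuclideanSpace ℝ (Fin 4)) M] [CompactSpace M] [IsManifold (𝓡 4) ∞ M] in
/-- The preferred chart of `ℂℙ¹` at the point at infinity `[0 : 1]` is the chart `1`. [folklore] -/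
theorem chartIndex_linePt_one_zero : chartIndex (CodimTwoData.linePt 1 0) = 1 :=
  chartIndex_affineChart_symm_zero 1

omit [T2Space M] [ChartedSpace (EuclideanSpace ℝ (Fin 4)) M] [CompactSpace M] [IsManifold (𝓡 4) ∞ M] in
/-- The coordinate derivative `Λ : ℝ² → ℂ` of the affine charts is onto. [folklore] -/
theorem surjective_coordLam :
    Surjective ((ContinuousLinearMap.proj (0 : Fin 1) : (Fin 1 → ℂ) →L[ℝ] ℂ).comp
      (realCoordinates 1).symm.toContinuousLinearMap) := by
  intro c
  refine ⟨realCoordinates 1 (fun _ => c), ?_⟩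
  simp

/-- **The tangent plane of the capped sphere at `p` is the `z`-plane**: every vector with vanishing
`w`-component is tangent to `û = capGlue u` at `∞`. [cite: Wendl2018, proof of Prop. 2.53 (p. 65)] -/
theorem IsPencilPlane.exists_mfderiv_capGlue_inf (h : IsPencilPlane J u b) (hε : 0 < ε)
    (hJstd : ∀ x : punctured p, InPuncturedChartBall p ε x →
      ∀ (v : TangentSpace (𝓡 4) x) (c : EuclideanSpace ℝ (Fin 4)),
        inner ℝ (fderiv ℝ inversion (extChartAt (𝓡 4) p x.1 - extChartAt (𝓡 4) p p)
          (mfderiv (𝓡 4) 𝓘(ℝ, EuclideanSpace ℝ (Fin 4))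
            (fun z : punctured p => extChartAt (𝓡 4) p z.1) x (J x v))) c
        = stdSymplecticForm (fderiv ℝ inversion (extChartAt (𝓡 4) p x.1 - extChartAt (𝓡 4) p p)
          (mfderiv (𝓡 4) 𝓘(ℝ, EuclideanSpace ℝ (Fin 4))
            (fun z : punctured p => extChartAt (𝓡 4) p z.1) x v)) c)
    {X : EuclideanSpace ℝ (Fin 4)} (hX : (flatCx X).2 = 0) :
    ∃ a, mfderiv (𝓡 2) (𝓡 4) (capGlue u) (CodimTwoData.linePt 1 0) a = X := by
  have hidx := chartIndex_linePt_one_zero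
  have h0 : affineCoordComplex 1 (CodimTwoData.linePt 1 0) 0 = 0 := CodimTwoData.affineCoordComplex_linePt 1 0
  have hG : ∀ q, CoordNeZero (chartIndex (CodimTwoData.linePt 1 0)) q →
      capGlue u q = pencilCap p u (affineCoordComplex (chartIndex (CodimTwoData.linePt 1 0)) q 0) := by
    rw [hidx]; exact fun q hq => capGlue_of_coordNeZero_one hq
  have hw : MDifferentiableAt 𝓘(ℝ, ℂ) (𝓡 4) (pencilCap p u)
      (affineCoordComplex (chartIndex (CodimTwoData.linePt 1 0)) (CodimTwoData.linePt 1 0) 0) := by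
    rw [hidx, h0]; exact (h.contMDiff_pencilCap hε hJstd 0).mdifferentiableAt (by simp)
  have hd := hasMFDerivAt_glued (w := pencilCap p u) (CodimTwoData.linePt 1 0) hG hw
  rw [hidx, h0, (h.hasMFDerivAt_pencilCap_zero hε hJstd).mfderiv] at hd
  -- `X = capTangent (conj (flatCx X).1)`
  have hXeq : capTangent (conj (flatCx X).1) = X := by
    apply flatCx.injective
    rw [flatCx_capTangent, Complex.conj_conj]
    ext1
    · rfl
    · exact hX.symm
  obtain ⟨a, ha⟩ := surjective_coordLam (conj (flatCx X).1)
  have key : ∃ a, mfderiv (𝓡 (2 * 1)) (𝓡 4) (capGlue u) (CodimTwoData.linePt 1 0) a = X := by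
    refine ⟨a, ?_⟩
    rw [hd.mfderiv]
    change capTangent (((ContinuousLinearMap.proj (0 : Fin 1) : (Fin 1 → ℂ) →L[ℝ] ℂ).comp
      (realCoordinates 1).symm.toContinuousLinearMap) a) = X
    rw [ha, hXeq]
  exact key

end CapTangent

/-! ### §3 A normal framing of the capped sphere and its `w`-component at infinity -/

section Framing

/-- **An embedded Riemann sphere in a compact homotopy `4`-sphere has a normal framing**
(Kirby's Theorem VIII.2 for `2`-spheres in homotopy `4`-spheres, framing form: linear maps
`N y : ℝ² →L T_{c y} M` smooth along `c` with `dc_y ⊕ N y` bijective).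
[cite: Kirby1989, Ch. VIII, Thm. 2, pp. 44–45] -/
theorem exists_normalFraming_of_homotopyEquiv_sphere_four {M : Type} [TopologicalSpace M]
    [T2Space M] [CompactSpace M] [ChartedSpace (EuclideanSpace ℝ (Fin 4)) M] [IsManifold (𝓡 4) ∞ M]
    (hM : Nonempty (ContinuousMap.HomotopyEquiv M (sphere (0 : EuclideanSpace ℝ (Fin 5)) 1)))
    (c : ComplexProjectiveSpace 1 → M) (hc : ContMDiff (𝓡 2) (𝓡 4) ∞ c) (hci : Injective c)
    (hdc : ∀ y, Injective (mfderiv (𝓡 2) (𝓡 4) c y)) :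
    ∃ N : ComplexProjectiveSpace 1 → (EuclideanSpace ℝ (Fin 2) →L[ℝ] EuclideanSpace ℝ (Fin 4)),
      IsSmoothAlong (𝓡 2) c N ∧ ∀ y, Bijective ((mfderiv (𝓡 2) (𝓡 4) c y).coprod (N y)) := by
  obtain ⟨e⟩ := hM
  obtain ⟨n, w, hw, hwemb, hdw⟩ := exists_embedding_euclidean_of_compact (I := 𝓡 4) (M := M)
  letI i1 : ChartedSpace (EuclideanSpace ℝ (Fin (2 + 2))) M :=
    inferInstanceAs (ChartedSpace (EuclideanSpace ℝ (Fin 4)) M)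
  haveI i2 : IsManifold (𝓡 (2 + 2)) ∞ M := inferInstanceAs (IsManifold (𝓡 4) ∞ M)
  let D : CodimTwoData 2 M (ComplexProjectiveSpace 1) (EuclideanSpace ℝ (Fin n)) :=
    ⟨w, c, hw, hwemb.injective, hdw, hc, hci, hdc⟩
  obtain ⟨J, hJ⟩ := D.exists_isRotationField_projectiveLine
  obtain ⟨a, ha, H, hH, hH0, hH1⟩ := exists_nullhomotopy_offRange e c
    (hc.of_le (by exact_mod_cast le_top))
  obtain ⟨N, hN, hbij⟩ := D.exists_isSmoothAlong_normalFraming hJ ha hH hH0 hH1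
  exact ⟨N, hN, hbij⟩

/-- The `w`-component (second flat coordinate) of a frame `F : ℝ² →L ℝ⁴`. [folklore] -/
def sndFlat (F : EuclideanSpace ℝ (Fin 2) →L[ℝ] EuclideanSpace ℝ (Fin 4)) :
    EuclideanSpace ℝ (Fin 2) →L[ℝ] ℂ :=
  (ContinuousLinearMap.snd ℝ ℂ ℂ).comp
    ((flatCx : EuclideanSpace ℝ (Fin 4) →L[ℝ] ℂ × ℂ).comp F)

/-- Values of `sndFlat`. [folklore] -/
@[simp] theorem sndFlat_apply (F : EuclideanSpace ℝ (Fin 2) →L[ℝ] EuclideanSpace ℝ (Fin 4))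
    (v : EuclideanSpace ℝ (Fin 2)) : sndFlat F v = (flatCx (F v)).2 := rfl

variable {M : Type} [TopologicalSpace M] [T2Space M] [CompactSpace M]
  [ChartedSpace (EuclideanSpace ℝ (Fin 4)) M] [IsManifold (𝓡 4) ∞ M]
  {p : M} {J : ∀ x : punctured p, TangentSpace (𝓡 4) x →L[ℝ] TangentSpace (𝓡 4) x}
  {u : ℂ → punctured p} {b : ℂ} {ε : ℝ}

/-- **The normal frame at `∞` has invertible `w`-component**: for a frame `N ∞` complementary to
the tangent plane of the capped sphere at `p` (the `z`-plane), `v ↦ (flatCx (N ∞ v)).2` is a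
bijection `ℝ² → ℂ`. [cite: Wendl2018, proof of Prop. 2.53 (p. 65)] -/
theorem IsPencilPlane.bijective_sndFlat_frame_inf (h : IsPencilPlane J u b) (hε : 0 < ε)
    (hJstd : ∀ x : punctured p, InPuncturedChartBall p ε x →
      ∀ (v : TangentSpace (𝓡 4) x) (c : EuclideanSpace ℝ (Fin 4)),
        inner ℝ (fderiv ℝ inversion (extChartAt (𝓡 4) p x.1 - extChartAt (𝓡 4) p p)
          (mfderiv (𝓡 4) 𝓘(ℝ, EuclideanSpace ℝ (Fin 4))
            (fun z : punctured p => extChartAt (𝓡 4) p z.1) x (J x v))) c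
        = stdSymplecticForm (fderiv ℝ inversion (extChartAt (𝓡 4) p x.1 - extChartAt (𝓡 4) p p)
          (mfderiv (𝓡 4) 𝓘(ℝ, EuclideanSpace ℝ (Fin 4))
            (fun z : punctured p => extChartAt (𝓡 4) p z.1) x v)) c)
    {F : EuclideanSpace ℝ (Fin 2) →L[ℝ] EuclideanSpace ℝ (Fin 4)}
    (hbij : Bijective ((mfderiv (𝓡 2) (𝓡 4) (capGlue u) (CodimTwoData.linePt 1 0)).coprod F)) :
    Bijective (sndFlat F) := by
  have hinj : Injective (sndFlat F) := by
    intro v₁ v₂ hv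
    have h0 : (flatCx (F (v₁ - v₂))).2 = 0 := by
      rw [map_sub, map_sub, Prod.snd_sub, sub_eq_zero]; exact hv
    obtain ⟨a, ha⟩ := h.exists_mfderiv_capGlue_inf hε hJstd h0
    have hz : ((mfderiv (𝓡 2) (𝓡 4) (capGlue u) (CodimTwoData.linePt 1 0)).coprod F)
        (a, -(v₁ - v₂)) = 0 := by
      rw [ContinuousLinearMap.coprod_apply, ha, map_neg]
      exact add_neg_cancel (F (v₁ - v₂))
    have h1 : (a, -(v₁ - v₂)) = 0 := hbij.1 (hz.trans (map_zero _).symm)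
    have h2 := congrArg Prod.snd h1
    simp only [Prod.snd_zero, neg_eq_zero, sub_eq_zero] at h2
    exact h2
  refine ⟨hinj, ?_⟩
  have hdim : Module.finrank ℝ (EuclideanSpace ℝ (Fin 2)) = Module.finrank ℝ ℂ := by
    rw [finrank_euclideanSpace_fin, Complex.finrank_real_complex]
  exact (LinearMap.injective_iff_surjective_of_finrank_eq_finrank
    (f := (sndFlat F).toLinearMap) hdim).1 hinj

/-- **The frame normaliser**: the automorphism `A` of `ℝ²` with `(flatCx (F (A c))).2 = e2c c`,
for a frame `F` with bijective `w`-component. [folklore] -/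
def frameNormaliser (F : EuclideanSpace ℝ (Fin 2) →L[ℝ] EuclideanSpace ℝ (Fin 4))
    (hb : Bijective (sndFlat F)) : EuclideanSpace ℝ (Fin 2) ≃L[ℝ] EuclideanSpace ℝ (Fin 2) :=
  e2c.trans (LinearEquiv.ofBijective (sndFlat F).toLinearMap hb).toContinuousLinearEquiv.symm

omit [T2Space M] [CompactSpace M] [ChartedSpace (EuclideanSpace ℝ (Fin 4)) M]
  [IsManifold (𝓡 4) ∞ M] in
/-- The defining property of the frame normaliser. [folklore] -/
theorem sndFlat_frameNormaliser (F : EuclideanSpace ℝ (Fin 2) →L[ℝ] EuclideanSpace ℝ (Fin 4))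
    (hb : Bijective (sndFlat F)) (c : EuclideanSpace ℝ (Fin 2)) :
    (flatCx (F (frameNormaliser F hb c))).2 = e2c c := by
  have h1 : sndFlat F (frameNormaliser F hb c) = e2c c := by
    change (LinearEquiv.ofBijective (sndFlat F).toLinearMap hb)
      ((LinearEquiv.ofBijective (sndFlat F).toLinearMap hb).symm (e2c c)) = e2c c
    exact LinearEquiv.apply_symm_apply _ _
  simpa using h1

end Framing


/-! ### §4 The core frame, the tangent-killing functional and the flat class estimate -/

section ClassDefect

/-- Local notation for the model space `ℝ⁴`. -/
local notation "E4" => EuclideanSpace ℝ (Fin 4)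

/-- `|s| ‖y‖ ≤ 2 ‖V‖` for the reflection coefficient `s = 2⟪y, V⟫/‖y‖²`. [folklore] -/
theorem abs_reflCoeff_mul_norm_le {y : E4} (hy : y ≠ 0) (V : E4) :
    |2 * ⟪y, V⟫ / ‖y‖ ^ 2| * ‖y‖ ≤ 2 * ‖V‖ := by
  have hpos : 0 < ‖y‖ := norm_pos_iff.2 hy
  rw [abs_div, abs_mul, abs_two, abs_of_pos (by positivity : (0 : ℝ) < ‖y‖ ^ 2)]
  have hcs : |⟪y, V⟫| ≤ ‖y‖ * ‖V‖ := abs_real_inner_le_norm y V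
  calc 2 * |⟪y, V⟫| / ‖y‖ ^ 2 * ‖y‖ = 2 * |⟪y, V⟫| / ‖y‖ := by field_simp
    _ ≤ 2 * (‖y‖ * ‖V‖) / ‖y‖ := by gcongr
    _ = 2 * ‖V‖ := by field_simp

/-- **The flat class defect estimate** (pure normed-space algebra): for `y ≠ 0`, slopes `z', w'`,
a vector `V` with reflected vector `V − s y` (`s = 2⟪y, V⟫/‖y‖²`) and a comparison vector `V∞`,
`‖z' (V − s y)_w − w' (V − s y)_z − (V∞)_w‖ ≤ (‖z' − 1‖ (1 + 2t) + 2t + 3‖w'‖) ‖V‖ + ‖V − V∞‖`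
with `t = ‖y_w‖/‖y‖` (subscripts: flat components). [folklore] -/
theorem norm_classDefect_le (V Vinf : E4) {y : E4} (hy : y ≠ 0) (zd wd : ℂ) :
    ‖zd * (flatCx (V - (2 * ⟪y, V⟫ / ‖y‖ ^ 2) • y)).2 -
        wd * (flatCx (V - (2 * ⟪y, V⟫ / ‖y‖ ^ 2) • y)).1 - (flatCx Vinf).2‖ ≤
      (‖zd - 1‖ * (1 + 2 * (‖(flatCx y).2‖ / ‖y‖)) + 2 * (‖(flatCx y).2‖ / ‖y‖) + 3 * ‖wd‖) * ‖V‖ +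
        ‖V - Vinf‖ := by
  have hpos : 0 < ‖y‖ := norm_pos_iff.2 hy
  set s : ℝ := 2 * ⟪y, V⟫ / ‖y‖ ^ 2 with hs
  set t : ℝ := ‖(flatCx y).2‖ / ‖y‖ with ht
  have ht0 : 0 ≤ t := by positivity
  have hst : |s| * ‖y‖ ≤ 2 * ‖V‖ := abs_reflCoeff_mul_norm_le hy V
  -- the two reflection corrections
  have hs1 : ‖s • (flatCx y).1‖ ≤ 2 * ‖V‖ := by
    rw [norm_smul, Real.norm_eq_abs]
    calc |s| * ‖(flatCx y).1‖ ≤ |s| * ‖y‖ := by gcongr; exact norm_flatCx_fst_le y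
      _ ≤ 2 * ‖V‖ := hst
  have hs2 : ‖s • (flatCx y).2‖ ≤ 2 * ‖V‖ * t := by
    rw [norm_smul, Real.norm_eq_abs]
    have h1 : ‖(flatCx y).2‖ = t * ‖y‖ := by rw [ht]; field_simp
    rw [h1]
    calc |s| * (t * ‖y‖) = (|s| * ‖y‖) * t := by ring
      _ ≤ 2 * ‖V‖ * t := by gcongr
  -- the three pieces
  set B : ℂ := (flatCx (V - s • y)).2 with hB
  set A' : ℂ := (flatCx (V - s • y)).1 with hA'
  set T : ℂ := (flatCx Vinf).2 with hT
  have hBeq : B = (flatCx V).2 - s • (flatCx y).2 := by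
    rw [hB, map_sub, map_smul]; rfl
  have hAeq : A' = (flatCx V).1 - s • (flatCx y).1 := by
    rw [hA', map_sub, map_smul]; rfl
  have hBn : ‖B‖ ≤ ‖V‖ + 2 * ‖V‖ * t := by
    rw [hBeq]
    calc ‖(flatCx V).2 - s • (flatCx y).2‖ ≤ ‖(flatCx V).2‖ + ‖s • (flatCx y).2‖ := norm_sub_le _ _
      _ ≤ ‖V‖ + 2 * ‖V‖ * t := add_le_add (norm_flatCx_snd_le V) hs2
  have hBT : ‖B - T‖ ≤ ‖V - Vinf‖ + 2 * ‖V‖ * t := by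
    rw [hBeq, hT]
    have h1 : (flatCx V).2 - s • (flatCx y).2 - (flatCx Vinf).2 =
        (flatCx (V - Vinf)).2 - s • (flatCx y).2 := by
      rw [map_sub]; simp only [Prod.snd_sub]; ring
    rw [h1]
    calc ‖(flatCx (V - Vinf)).2 - s • (flatCx y).2‖
        ≤ ‖(flatCx (V - Vinf)).2‖ + ‖s • (flatCx y).2‖ := norm_sub_le _ _
      _ ≤ ‖V - Vinf‖ + 2 * ‖V‖ * t := add_le_add (norm_flatCx_snd_le _) hs2
  have hAn : ‖A'‖ ≤ 3 * ‖V‖ := by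
    rw [hAeq]
    calc ‖(flatCx V).1 - s • (flatCx y).1‖ ≤ ‖(flatCx V).1‖ + ‖s • (flatCx y).1‖ := norm_sub_le _ _
      _ ≤ ‖V‖ + 2 * ‖V‖ := add_le_add (norm_flatCx_fst_le V) hs1
      _ = 3 * ‖V‖ := by ring
  -- assemble
  have hexpr : zd * B - wd * A' - T = (zd - 1) * B + (B - T) - wd * A' := by ring
  rw [hexpr]
  calc ‖(zd - 1) * B + (B - T) - wd * A'‖
      ≤ ‖(zd - 1) * B‖ + ‖B - T‖ + ‖wd * A'‖ := norm_sub_le_of_le (norm_add_le _ _) le_rfl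
    _ = ‖zd - 1‖ * ‖B‖ + ‖B - T‖ + ‖wd‖ * ‖A'‖ := by rw [norm_mul, norm_mul]
    _ ≤ ‖zd - 1‖ * (‖V‖ + 2 * ‖V‖ * t) + (‖V - Vinf‖ + 2 * ‖V‖ * t) + ‖wd‖ * (3 * ‖V‖) := by
        gcongr
    _ = (‖zd - 1‖ * (1 + 2 * t) + 2 * t + 3 * ‖wd‖) * ‖V‖ + ‖V - Vinf‖ := by ring

end ClassDefect

section Core

variable {M : Type} [TopologicalSpace M] [T2Space M] [ChartedSpace (EuclideanSpace ℝ (Fin 4)) M]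
  [IsManifold (𝓡 4) ∞ M]
  {p : M} {J : ∀ x : punctured p, TangentSpace (𝓡 4) x →L[ℝ] TangentSpace (𝓡 4) x}
  {u : ℂ → punctured p} {b : ℂ} {ε : ℝ}

/-- **The core normal frame** of the compactified member along the finite part: the `M`-frame
`N (σ₀ ξ)` at `û(σ₀ ξ) = u ξ`, precomposed with an automorphism `A` of `ℝ²` (normalising its
`w`-components at `∞`) and rescaled by the conformal factor `‖e(u ξ) − e p‖²` of the inversion.
[cite: Wendl2018, proof of Prop. 2.53 (p. 65)] -/
def coreFrame (p : M) (u : ℂ → punctured p)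
    (N : ComplexProjectiveSpace 1 → EuclideanSpace ℝ (Fin 2) →L[ℝ] EuclideanSpace ℝ (Fin 4))
    (A : EuclideanSpace ℝ (Fin 2) →L[ℝ] EuclideanSpace ℝ (Fin 2)) (ξ : ℂ) :
    EuclideanSpace ℝ (Fin 2) →L[ℝ] EuclideanSpace ℝ (Fin 4) :=
  (‖recentre p (u ξ).1‖ ^ 2) • ((N (CodimTwoData.linePt 0 ξ)).comp A)

omit [IsManifold (𝓡 4) ∞ M] in
/-- Values of the core frame. [folklore] -/
theorem coreFrame_apply
    (N : ComplexProjectiveSpace 1 → EuclideanSpace ℝ (Fin 2) →L[ℝ] EuclideanSpace ℝ (Fin 4))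
    (A : EuclideanSpace ℝ (Fin 2) →L[ℝ] EuclideanSpace ℝ (Fin 2)) (ξ : ℂ) (c : EuclideanSpace ℝ (Fin 2)) :
    coreFrame p u N A ξ c = (‖recentre p (u ξ).1‖ ^ 2) • N (CodimTwoData.linePt 0 ξ) (A c) := rfl

/-- **The tangent-killing functional** of flat coordinates `L` with complex slopes `(z', w')`:
`V ↦ z' (L V).2 − w' (L V).1`. [folklore] -/
def tanKill (zd wd : ℂ) (L : EuclideanSpace ℝ (Fin 4) →L[ℝ] ℂ × ℂ) : EuclideanSpace ℝ (Fin 4) →L[ℝ] ℂ :=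
  zd • ((ContinuousLinearMap.snd ℝ ℂ ℂ).comp L) - wd • ((ContinuousLinearMap.fst ℝ ℂ ℂ).comp L)

omit [T2Space M] [ChartedSpace (EuclideanSpace ℝ (Fin 4)) M] [IsManifold (𝓡 4) ∞ M] in
/-- Values of the tangent-killing functional. [folklore] -/
@[simp] theorem tanKill_apply (zd wd : ℂ) (L : EuclideanSpace ℝ (Fin 4) →L[ℝ] ℂ × ℂ)
    (V : EuclideanSpace ℝ (Fin 4)) : tanKill zd wd L V = zd * (L V).2 - wd * (L V).1 := by
  simp [tanKill]

/-- **The flat derivative of the member's tangent vectors**: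
`flatDeriv (u ξ) (du(ξ) a) = d(pencilCoord ∘ u)(ξ) a`. [folklore] -/
theorem flatDeriv_mfderiv_apply {ξ : ℂ} (hu : MDifferentiableAt 𝓘(ℝ, ℂ) (𝓡 4) u ξ)
    (hx : (u ξ).1 ∈ (chartAt (EuclideanSpace ℝ (Fin 4)) p).source) (a : ℂ) :
    flatDeriv p (u ξ).1 (mfderiv 𝓘(ℝ, ℂ) (𝓡 4) u ξ a) =
      fderiv ℝ (fun η : ℂ => pencilCoord p (u η)) ξ a := by
  have h1 := (hasMFDerivAt_flatChart hx (extChartAt_sub_ne_zero (u ξ) hx)).comp ξ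
    (hasMFDerivAt_val_comp hu)
  have hfun : (flatChart p ∘ fun ξ => (u ξ).1) = fun η : ℂ => pencilCoord p (u η) :=
    funext fun η => flatChart_val p (u η)
  rw [hfun] at h1
  have h2 := h1.mfderiv
  rw [mfderiv_eq_fderiv] at h2
  rw [h2]
  rfl

/-- **The tangent-killing functional kills the tangent plane of the member**:
`Λ_ξ (du(ξ) a) = z' (a w') − w' (a z') = 0`. [cite: Wendl2018, proof of Prop. 2.53 (p. 65)] -/
theorem tanKill_flatDeriv_mfderiv {ξ : ℂ} (hu : MDifferentiableAt 𝓘(ℝ, ℂ) (𝓡 4) u ξ)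
    (hx : (u ξ).1 ∈ (chartAt (EuclideanSpace ℝ (Fin 4)) p).source)
    (hd : DifferentiableAt ℂ (fun η : ℂ => pencilCoord p (u η)) ξ) (a : ℂ) :
    tanKill (deriv (fun η : ℂ => (pencilCoord p (u η)).1) ξ)
      (deriv (fun η : ℂ => (pencilCoord p (u η)).2) ξ) (flatDeriv p (u ξ).1)
        (mfderiv 𝓘(ℝ, ℂ) (𝓡 4) u ξ a) = 0 := by
  rw [tanKill_apply, flatDeriv_mfderiv_apply hu hx, fderiv_real_pencilCoord_comp_apply hd]
  ring

/-- **The tangent-killing functional of the far frame** is `z' c`. [folklore] -/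
theorem PencilEnd.tanKill_farFrame (G : PencilEnd p) {ξ : ℂ} (hx : u ξ ∈ G.src) (zd wd : ℂ)
    (c : EuclideanSpace ℝ (Fin 2)) :
    tanKill zd wd (flatDeriv p (u ξ).1) (farFrame p u ξ c) = zd * e2c c := by
  rw [tanKill_apply, G.flatDeriv_farFrame_apply hx]
  ring

/-- **The flat derivative of the core frame is a scaled reflection**:
`flatDeriv (coreFrame ξ c) = flatCx (‖y‖² Dι(y) (Φ_ξ (A c)))`, `y = e(u ξ) − e p`,
`Φ_ξ = τ_{u ξ → p} ∘ N(σ₀ ξ)`. [folklore] -/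
theorem flatDeriv_coreFrame_apply
    (N : ComplexProjectiveSpace 1 → EuclideanSpace ℝ (Fin 2) →L[ℝ] EuclideanSpace ℝ (Fin 4))
    (A : EuclideanSpace ℝ (Fin 2) →L[ℝ] EuclideanSpace ℝ (Fin 2)) (ξ : ℂ) (c : EuclideanSpace ℝ (Fin 2)) :
    flatDeriv p (u ξ).1 (coreFrame p u N A ξ c) =
      flatCx ((‖recentre p (u ξ).1‖ ^ 2) • inversionDeriv (recentre p (u ξ).1)
        (tangentCoordChange (𝓡 4) (u ξ).1 p (u ξ).1 (N (CodimTwoData.linePt 0 ξ) (A c)))) := by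
  rw [coreFrame_apply, flatDeriv]
  simp only [ContinuousLinearMap.comp_apply, ContinuousLinearEquiv.coe_coe, map_smul]

/-- **The class defect of the core frame, pointwise**: with `Φ = τ_{u ξ → p} ∘ N(σ₀ ξ)`,
`V = Φ (A c)`, `V∞ = N(∞) (A c)`, `y = e(u ξ) − e p ≠ 0`, `t = ‖y_w‖/‖y‖`:
`‖Λ_ξ (coreFrame ξ c) − (V∞)_w‖ ≤ (‖z' − 1‖ (1 + 2t) + 2t + 3‖w'‖) ‖V‖ + ‖V − V∞‖`. [folklore] -/
theorem norm_tanKill_coreFrame_sub_le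
    (N : ComplexProjectiveSpace 1 → EuclideanSpace ℝ (Fin 2) →L[ℝ] EuclideanSpace ℝ (Fin 4))
    (A : EuclideanSpace ℝ (Fin 2) →L[ℝ] EuclideanSpace ℝ (Fin 2)) {ξ : ℂ}
    (hy : recentre p (u ξ).1 ≠ 0) (zd wd : ℂ) (c : EuclideanSpace ℝ (Fin 2)) :
    ‖tanKill zd wd (flatDeriv p (u ξ).1) (coreFrame p u N A ξ c) -
        (flatCx (N (CodimTwoData.linePt 1 0) (A c))).2‖ ≤
      (‖zd - 1‖ * (1 + 2 * (‖(flatCx (recentre p (u ξ).1)).2‖ / ‖recentre p (u ξ).1‖)) +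
          2 * (‖(flatCx (recentre p (u ξ).1)).2‖ / ‖recentre p (u ξ).1‖) + 3 * ‖wd‖) *
        ‖tangentCoordChange (𝓡 4) (u ξ).1 p (u ξ).1 (N (CodimTwoData.linePt 0 ξ) (A c))‖ +
      ‖tangentCoordChange (𝓡 4) (u ξ).1 p (u ξ).1 (N (CodimTwoData.linePt 0 ξ) (A c)) -
        N (CodimTwoData.linePt 1 0) (A c)‖ := by
  rw [tanKill_apply, flatDeriv_coreFrame_apply, norm_sq_smul_inversionDeriv_apply hy]
  exact norm_classDefect_le _ _ hy zd wd

/-- The frame `Φ_ξ = τ_{u ξ → p} ∘ N(σ₀ ξ)` is the `M`-framing of the capped sphere read in the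
chart at `p`. [folklore] -/
theorem frameIn_capGlue_linePt_zero
    (N : ComplexProjectiveSpace 1 → EuclideanSpace ℝ (Fin 2) →L[ℝ] EuclideanSpace ℝ (Fin 4))
    (ξ : ℂ) :
    frameIn (capGlue u) N p (CodimTwoData.linePt 0 ξ) =
      (tangentCoordChange (𝓡 4) (u ξ).1 p (u ξ).1).comp (N (CodimTwoData.linePt 0 ξ)) := by
  rw [frameIn, capGlue_of_coordNeZero_zero (CodimTwoData.coordNeZero_linePt 0 ξ),
    CodimTwoData.affineCoordComplex_linePt]

/-- At `∞` the framing read in the chart at `p = û(∞)` is `N ∞` itself. [folklore] -/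
theorem frameIn_capGlue_linePt_one_zero
    (N : ComplexProjectiveSpace 1 → EuclideanSpace ℝ (Fin 2) →L[ℝ] EuclideanSpace ℝ (Fin 4)) :
    frameIn (capGlue u) N p (CodimTwoData.linePt 1 0) = N (CodimTwoData.linePt 1 0) := by
  have hinf : capGlue u (CodimTwoData.linePt 1 0) = p := by
    rw [capGlue_of_coordNeZero_one (CodimTwoData.coordNeZero_linePt 1 0),
      CodimTwoData.affineCoordComplex_linePt, pencilCap_zero]
  ext1 v
  rw [frameIn_apply, hinf, tangentCoordChange_self (mem_extChartAt_source (I := 𝓡 4) p)]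

variable [CompactSpace M]

/-- **The `M`-framing read in the chart at `p` is continuous at infinity along the member**:
`Φ_ξ → N(∞)` as `ξ → ∞`. [folklore] -/
theorem IsPencilPlane.tendsto_frameIn_capGlue (h : IsPencilPlane J u b) (hε : 0 < ε)
    (hJstd : ∀ x : punctured p, InPuncturedChartBall p ε x →
      ∀ (v : TangentSpace (𝓡 4) x) (c : EuclideanSpace ℝ (Fin 4)),
        inner ℝ (fderiv ℝ inversion (extChartAt (𝓡 4) p x.1 - extChartAt (𝓡 4) p p)
          (mfderiv (𝓡 4) 𝓘(ℝ, EuclideanSpace ℝ (Fin 4))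
            (fun z : punctured p => extChartAt (𝓡 4) p z.1) x (J x v))) c
        = stdSymplecticForm (fderiv ℝ inversion (extChartAt (𝓡 4) p x.1 - extChartAt (𝓡 4) p p)
          (mfderiv (𝓡 4) 𝓘(ℝ, EuclideanSpace ℝ (Fin 4))
            (fun z : punctured p => extChartAt (𝓡 4) p z.1) x v)) c)
    {N : ComplexProjectiveSpace 1 → EuclideanSpace ℝ (Fin 2) →L[ℝ] EuclideanSpace ℝ (Fin 4)}
    (hN : IsSmoothAlong (𝓡 2) (capGlue u) N) :
    Tendsto (fun ξ : ℂ => (tangentCoordChange (𝓡 4) (u ξ).1 p (u ξ).1).comp (N (CodimTwoData.linePt 0 ξ)))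
      (cocompact ℂ) (𝓝 (N (CodimTwoData.linePt 1 0))) := by
  have hcont : Continuous (capGlue u) := (h.capGlue_smooth_injective_immersion hε hJstd).1.continuous
  have hinf : capGlue u (CodimTwoData.linePt 1 0) = p := by
    rw [capGlue_of_coordNeZero_one (CodimTwoData.coordNeZero_linePt 1 0),
      CodimTwoData.affineCoordComplex_linePt, pencilCap_zero]
  have hopen : IsOpen (capGlue u ⁻¹' (chartAt (EuclideanSpace ℝ (Fin 4)) p).source) :=
    (chartAt (EuclideanSpace ℝ (Fin 4)) p).open_source.preimage hcont
  have hmem : CodimTwoData.linePt 1 0 ∈ capGlue u ⁻¹' (chartAt (EuclideanSpace ℝ (Fin 4)) p).source := by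
    show capGlue u (CodimTwoData.linePt 1 0) ∈ (chartAt (EuclideanSpace ℝ (Fin 4)) p).source
    rw [hinf]; exact mem_chart_source _ p
  have hca : ContinuousAt (frameIn (capGlue u) N p) (CodimTwoData.linePt 1 0) :=
    ((hN p).contMDiffAt (hopen.mem_nhds hmem)).continuousAt
  have h1 := hca.tendsto.comp tendsto_linePt_zero_cocompact
  rw [frameIn_capGlue_linePt_one_zero] at h1
  refine h1.congr fun ξ => ?_
  exact frameIn_capGlue_linePt_zero N ξ

/-- **The class defect of the core frame tends to zero at infinity.** Given `δ > 0`, for `‖ξ‖`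
large: `u ξ` is in the punctured chart ball, the flat coordinates of the member are complex
differentiable at `ξ`, `‖z'(ξ) − 1‖ ≤ δ`, and for every `c`,
`‖Λ_ξ (coreFrame ξ c) − (N(∞)(A c))_w‖ ≤ δ ‖c‖`.
[cite: Wendl2018, proof of Prop. 2.53 (p. 65)] -/
theorem IsPencilPlane.eventually_tanKill_coreFrame (h : IsPencilPlane J u b) (hε : 0 < ε)
    (hJstd : ∀ x : punctured p, InPuncturedChartBall p ε x →
      ∀ (v : TangentSpace (𝓡 4) x) (c : EuclideanSpace ℝ (Fin 4)),
        inner ℝ (fderiv ℝ inversion (extChartAt (𝓡 4) p x.1 - extChartAt (𝓡 4) p p)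
          (mfderiv (𝓡 4) 𝓘(ℝ, EuclideanSpace ℝ (Fin 4))
            (fun z : punctured p => extChartAt (𝓡 4) p z.1) x (J x v))) c
        = stdSymplecticForm (fderiv ℝ inversion (extChartAt (𝓡 4) p x.1 - extChartAt (𝓡 4) p p)
          (mfderiv (𝓡 4) 𝓘(ℝ, EuclideanSpace ℝ (Fin 4))
            (fun z : punctured p => extChartAt (𝓡 4) p z.1) x v)) c)
    {N : ComplexProjectiveSpace 1 → EuclideanSpace ℝ (Fin 2) →L[ℝ] EuclideanSpace ℝ (Fin 4)}
    (hN : IsSmoothAlong (𝓡 2) (capGlue u) N)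
    (A : EuclideanSpace ℝ (Fin 2) →L[ℝ] EuclideanSpace ℝ (Fin 2)) {δ : ℝ} (hδ : 0 < δ) :
    ∀ᶠ ξ in cocompact ℂ, InPuncturedChartBall p ε (u ξ) ∧
      DifferentiableAt ℂ (fun η : ℂ => pencilCoord p (u η)) ξ ∧
      ‖deriv (fun η : ℂ => (pencilCoord p (u η)).1) ξ - 1‖ ≤ δ ∧
      ∀ c : EuclideanSpace ℝ (Fin 2),
        ‖tanKill (deriv (fun η : ℂ => (pencilCoord p (u η)).1) ξ)
            (deriv (fun η : ℂ => (pencilCoord p (u η)).2) ξ) (flatDeriv p (u ξ).1)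
            (coreFrame p u N A ξ c) - (flatCx (N (CodimTwoData.linePt 1 0) (A c))).2‖ ≤ δ * ‖c‖ := by
  -- the four asymptotic inputs
  set zd : ℂ → ℂ := fun ξ => deriv (fun η : ℂ => (pencilCoord p (u η)).1) ξ with hzd
  set wd : ℂ → ℂ := fun ξ => deriv (fun η : ℂ => (pencilCoord p (u η)).2) ξ with hwd
  set t : ℂ → ℝ := fun ξ => ‖(flatCx (recentre p (u ξ).1)).2‖ / ‖recentre p (u ξ).1‖ with ht
  set Φ : ℂ → (EuclideanSpace ℝ (Fin 2) →L[ℝ] EuclideanSpace ℝ (Fin 4)) := fun ξ =>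
    (tangentCoordChange (𝓡 4) (u ξ).1 p (u ξ).1).comp (N (CodimTwoData.linePt 0 ξ)) with hΦ
  set Φinf := N (CodimTwoData.linePt 1 0) with hΦinf
  have h1 : Tendsto (fun ξ => ‖zd ξ - 1‖) (cocompact ℂ) (𝓝 0) := by
    have := (h.tendsto_deriv_fst hε hJstd).sub_const 1
    rw [sub_self] at this
    simpa using this.norm
  have h2 : Tendsto t (cocompact ℂ) (𝓝 0) := h.tendsto_flatCx_snd_div_norm
  have h3 : Tendsto (fun ξ => ‖wd ξ‖) (cocompact ℂ) (𝓝 0) := by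
    simpa using (h.tendsto_deriv_snd hε hJstd).norm
  have h4 : Tendsto Φ (cocompact ℂ) (𝓝 Φinf) := h.tendsto_frameIn_capGlue hε hJstd hN
  have h4n : Tendsto (fun ξ => ‖Φ ξ‖) (cocompact ℂ) (𝓝 ‖Φinf‖) := h4.norm
  have h4d : Tendsto (fun ξ => ‖Φ ξ - Φinf‖) (cocompact ℂ) (𝓝 0) := by
    have := h4.sub_const Φinf
    rw [sub_self] at this
    simpa using this.norm
  -- the coefficient `K ξ → 0`
  set K : ℂ → ℝ := fun ξ =>
    (‖zd ξ - 1‖ * (1 + 2 * t ξ) + 2 * t ξ + 3 * ‖wd ξ‖) * ‖Φ ξ‖ + ‖Φ ξ - Φinf‖ with hK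
  have hK0 : Tendsto K (cocompact ℂ) (𝓝 0) := by
    have ha : Tendsto (fun ξ => ‖zd ξ - 1‖ * (1 + 2 * t ξ) + 2 * t ξ + 3 * ‖wd ξ‖)
        (cocompact ℂ) (𝓝 0) := by
      have := ((h1.mul ((h2.const_mul 2).const_add 1)).add (h2.const_mul 2)).add (h3.const_mul 3)
      simpa using this
    have hb := (ha.mul h4n).add h4d
    simpa using hb
  have hKA : Tendsto (fun ξ => K ξ * ‖A‖) (cocompact ℂ) (𝓝 0) := by
    simpa using hK0.mul_const ‖A‖
  -- eventual statements
  have e1 : ∀ᶠ ξ in cocompact ℂ, InPuncturedChartBall p ε (u ξ) := h.eventually_inPuncturedChartBall hε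
  have e2 : ∀ᶠ ξ in cocompact ℂ, DifferentiableAt ℂ (fun η : ℂ => pencilCoord p (u η)) ξ :=
    h.eventually_differentiableAt_pencilCoord hε hJstd
  have e3 : ∀ᶠ ξ in cocompact ℂ, ‖zd ξ - 1‖ < δ := (tendsto_order.1 h1).2 δ hδ
  have e4 : ∀ᶠ ξ in cocompact ℂ, K ξ * ‖A‖ < δ := (tendsto_order.1 hKA).2 δ hδ
  have e5 : ∀ᶠ ξ in cocompact ℂ, 0 ≤ K ξ := by
    filter_upwards with ξ
    positivity
  filter_upwards [e1, e2, e3, e4, e5] with ξ hx hd hz hKδ hKnn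
  refine ⟨hx, hd, hz.le, fun c => ?_⟩
  have hy : recentre p (u ξ).1 ≠ 0 := extChartAt_sub_ne_zero (u ξ) hx.1
  have hmain := norm_tanKill_coreFrame_sub_le (p := p) (u := u) N A hy (zd ξ) (wd ξ) c
  -- bound `‖V‖ ≤ ‖Φ ξ‖ ‖A‖ ‖c‖` and `‖V - V∞‖ ≤ ‖Φ ξ - Φinf‖ ‖A‖ ‖c‖`
  have hV : ‖tangentCoordChange (𝓡 4) (u ξ).1 p (u ξ).1 (N (CodimTwoData.linePt 0 ξ) (A c))‖ ≤
      ‖Φ ξ‖ * (‖A‖ * ‖c‖) := by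
    have : tangentCoordChange (𝓡 4) (u ξ).1 p (u ξ).1 (N (CodimTwoData.linePt 0 ξ) (A c)) = Φ ξ (A c) := rfl
    rw [this]
    exact (Φ ξ).le_opNorm_of_le (A.le_opNorm c)
  have hVd : ‖tangentCoordChange (𝓡 4) (u ξ).1 p (u ξ).1 (N (CodimTwoData.linePt 0 ξ) (A c)) -
      N (CodimTwoData.linePt 1 0) (A c)‖ ≤ ‖Φ ξ - Φinf‖ * (‖A‖ * ‖c‖) := by
    have : tangentCoordChange (𝓡 4) (u ξ).1 p (u ξ).1 (N (CodimTwoData.linePt 0 ξ) (A c)) -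
        N (CodimTwoData.linePt 1 0) (A c) = (Φ ξ - Φinf) (A c) := rfl
    rw [this]
    exact (Φ ξ - Φinf).le_opNorm_of_le (A.le_opNorm c)
  have hcoef : 0 ≤ ‖zd ξ - 1‖ * (1 + 2 * t ξ) + 2 * t ξ + 3 * ‖wd ξ‖ := by
    have : 0 ≤ t ξ := by rw [ht]; positivity
    positivity
  calc ‖tanKill (zd ξ) (wd ξ) (flatDeriv p (u ξ).1) (coreFrame p u N A ξ c) -
          (flatCx (N (CodimTwoData.linePt 1 0) (A c))).2‖
      ≤ (‖zd ξ - 1‖ * (1 + 2 * t ξ) + 2 * t ξ + 3 * ‖wd ξ‖) *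
          ‖tangentCoordChange (𝓡 4) (u ξ).1 p (u ξ).1 (N (CodimTwoData.linePt 0 ξ) (A c))‖ +
        ‖tangentCoordChange (𝓡 4) (u ξ).1 p (u ξ).1 (N (CodimTwoData.linePt 0 ξ) (A c)) -
          N (CodimTwoData.linePt 1 0) (A c)‖ := hmain
    _ ≤ (‖zd ξ - 1‖ * (1 + 2 * t ξ) + 2 * t ξ + 3 * ‖wd ξ‖) * (‖Φ ξ‖ * (‖A‖ * ‖c‖)) +
        ‖Φ ξ - Φinf‖ * (‖A‖ * ‖c‖) := by gcongr
    _ = (K ξ * ‖A‖) * ‖c‖ := by rw [hK]; ring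
    _ ≤ δ * ‖c‖ := by gcongr

end Core

end Literature.Geometry.Symplectic
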